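import Summits.AtomisticToContinuum.Crystallization.Theorems.OverbindingBudgetPeriodicPricing

/-!
# OverbindingBudget — the REGULARITY CUT of the pricing piece: statements, the energy-extremal reduction, the severity cut
(helper, `--supports stmt-AtomisticToContinuum-31280`; decomp-a2c lens 4 «minimal counterexample / extremal reduction», generation 24; node
«RegularityCut», file 1 of 2)

Route `OverbindingBudget` (Crystallization), crux `RobustDefectLimitWindows` (RDEF, stmt-AtomisticToContinuum-31280), registered line v7
«HostedDustCut» (sha 624a0fa0…, untouched).  Piece of record before this node (generation 23, critic row 322): the one-law cone
`…PeriodicPricingStatements.rdef_of_typeFreeLaw_coherent : TypeFreeLaw 10 → CleanlessExcessT → CoherentResidual 10 → RDEF`, with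
`TypeFreeLaw D` ("`L`-dense `t`-robust violators of the relaxed gapped-twelve test `RT` in a `9/10`-covering uniformly discrete texture with
thin cores of radius `D` CHARGE large cubes: site charge `> η ℓ³`") reduced to periodic textures (`PeriodicDefectPricing`).  Nothing is registered,
re-cut or re-typed here.

## The lens, applied to `TypeFreeLaw`

A MINIMAL counterexample to `TypeFreeLaw` inside the world of the crux is a chemical-potential ground state (`IsMuGSC lennardJones e Y`, a
hypothesis of RDEF), and the landed cube charge law `cubeChargeLaw` (stmt-30251) says that such a texture has site charge `o(ℓ³)` on ALL large
cubes.  Hence, on the extremal class, the pricing law is not a pricing statement at all but a RIGIDITY statement: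

* **`MuCleanBalls D`** (§A): a `9/10`-covering uniformly discrete `μ`-ground state at the limiting energy density `e` with thin cores of radius
  `D` has, at every admissible spacing `a ∈ [47/50, 1]` and every margin `t ∈ (0, 1/10]`, `t`-CLEAN BALLS OF EVERY RADIUS (a site `q` all of whose
  `L`-neighbours pass `RT a t`).  It is WEAKER than `TypeFreeLaw D` (`muCleanBalls_of_typeFreeLaw`, by `cubeChargeLaw`), it still closes the hosted
  world (`hostedTarget_of_muCleanBalls`: RDEF's `ROBUST` hypothesis says precisely that at some margin NO ball of some radius is clean) and hence
  the crux modulo the two residuals of record (`rdef_of_muCleanBalls_coherent`), and it deletes ten of RDEF's hypotheses (energy ground states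
  `x`, the root, recurrence, the two-way local limit, `GAP`, `APER`, the isochoric bounds, `¬ISO`, the signed charge, `¬FAT`) — an intrinsic
  property of the texture `Y`, strictly between `TypeFreeLaw 10` and `HostedTarget 10`.

* **The severity cut** (§B), exact for every threshold `T₀ ∈ (0, 1/10]`:
  `MuCleanBalls D ⟺ GrossCleanBalls T₀ D ∧ SoftCleanBalls T₀ D` (`muCleanBalls_iff_gross_soft`).
  `GrossCleanBalls T₀ D` = the law at the single margin `T₀` (GROSS violators — wrong coordination, or a neighbour distance off by more than
  `T₀` — are not `L`-dense in a `μ`-ground state: the PRICING residual, instrumentable on periodic textures exactly as census I-PDP at `t = T₀`);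
  `SoftCleanBalls T₀ D` = the law for margins `t < T₀` on textures that already have `T₀`-clean balls of every radius (SOFT violators — correct
  gapped-twelve type, distances off by less than `T₀` — do not persist at density: a REGULARITY statement).

* **ε-regularity** (§C): `SoftCleanBalls T₀ D ⟸ CleanRegularity T₀ D` (`softCleanBalls_of_cleanRegularity`), the local, quantitative form —
  for every `t` and `L` there is `R = R(e, δ, a, t, L)` such that every `T₀`-clean `R`-ball of a `δ`-separated `μ`-ground state contains a
  `t`-clean `L`-ball.  File 2 (`…RegularityCutLimit`) proves `CleanRegularity T₀ D ⟸ CleanLiouville T₀ D` (the blow-down: a GLOBALLY `T₀`-clean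
  `μ`-ground state is clean at every positive margin) modulo the limit-closedness of `μ`-ground states under two-way local matchings
  (`MuGSCLimitClosed`, §D; folklore, Sütő 2005 Thm 2-style; proved verbatim for the sibling import world as
  `…RepetitiveNetworkReductionRecurrentMember.isMuGSC_of_limit`).

Recommended threshold `T₀ = 1/250` (card NODE-g24-RegularityCut.md §3: a breathing icosahedral 13-cluster at spacing `a` passes `RT a t` at all
thirteen sites iff `t ≳ 0.0051 a`; below `1/250` icosahedral matter is GROSS, so the soft side sees only elastically strained close-packed matter).

Contents: §A statements of the extremal class and its cone; §B the severity cut; §C ε-regularity and the Liouville statement; §D the closure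
hypothesis.  All proofs complete (0 sorry), over landed Theorems files only.
-/

namespace Summit.AtomisticToContinuum.Crystallization.Theorems.OverbindingBudgetRegularityCutStatements

open scoped BigOperators Topology
open Literature.MathematicalPhysics.StatisticalMechanics (UniformlyDiscrete IsMuGSC lennardJones groundStateEnergy Match)
open Summit.AtomisticToContinuum.Crystallization.Theses.OverbindingBudget (RobustDefectLimitWindows CubeChargeLaw)
open Summit.AtomisticToContinuum.Crystallization.Theorems.OverbindingBudgetViolatorDensityFloor (GT RT)
open Summit.AtomisticToContinuum.Crystallization.Theorems.OverbindingBudgetWallTensionLever (BarlowClose MAT CleanT ThinCores)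
open Summit.AtomisticToContinuum.Crystallization.Theorems.OverbindingBudgetCleanlessCut (Hosted HostedTarget)
open Summit.AtomisticToContinuum.Crystallization.Theorems.OverbindingBudgetGradedBareness (CleanlessExcessT)
open Summit.AtomisticToContinuum.Crystallization.Theorems.OverbindingBudgetCoherentCut (CoherentResidual rdef_of_hosted_graded_coherent)
open Summit.AtomisticToContinuum.Crystallization.Theorems.OverbindingBudgetCubeChargeLaw (cubeChargeLaw)
open Summit.AtomisticToContinuum.Crystallization.Theorems.OverbindingBudgetRecurrentDustStatements (ThinCoresL rt_mono thinCoresL_of_thinCores)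
open Summit.AtomisticToContinuum.Crystallization.Theorems.OverbindingBudgetPeriodicPricingStatements (TypeFreeLaw PeriodicDefectPricing
  hostedTarget_of_typeFreeLaw typeFreeLaw_mono)
open Summit.AtomisticToContinuum.Crystallization.Theorems.OverbindingBudgetPeriodicPricing (typeFreeLaw_of_periodicDefectPricing)

/-! ## §A  The extremal class: `μ`-ground states have clean balls of every radius -/

/-- **`MuCleanBalls D`** — `TypeFreeLaw D` on its extremal class, read through the cube charge law.  For every limiting energy density `e`
(`TEND`, `LB`), every uniformly discrete `9/10`-covering `μ`-ground state `Y` at chemical potential `e` with thin cores of radius `D` at an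
admissible spacing `a ∈ [47/50, 1]`, every margin `t ∈ (0, 1/10]` and every radius `L`: some site `q ∈ Y` has ALL sites of `Y` within `L` passing
the relaxed gapped-twelve test `RT a t` (a `t`-clean `L`-ball).  Equivalently: `t`-robust violators are not `L`-dense. -/
def MuCleanBalls (D : ℝ) : Prop :=
  ∀ e : ℝ, Filter.Tendsto (fun N : ℕ => groundStateEnergy lennardJones 3 N / N) Filter.atTop (nhds e) →
    (∀ N : ℕ, 0 < N → e ≤ groundStateEnergy lennardJones 3 N / N) →
    ∀ Y : Set (EuclideanSpace ℝ (Fin 3)), UniformlyDiscrete Y → (∀ z : EuclideanSpace ℝ (Fin 3), ∃ w ∈ Y, dist z w < 9 / 10) →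
      IsMuGSC lennardJones e Y →
      ∀ a : ℝ, 47 / 50 ≤ a → a ≤ 1 → ∀ t : ℝ, 0 < t → t ≤ 1 / 10 → ∀ L : ℝ, ThinCores a D Y →
        ∃ q ∈ Y, ∀ y ∈ Y, dist y q ≤ L → RT a t Y y

/-- **The energy-extremal reduction.**  `TypeFreeLaw D → MuCleanBalls D`: were the `t`-robust violators `L`-dense in a `μ`-ground state, the
type-free law would charge some cube of every large side by `> η ℓ³`, contradicting the cube charge law `cubeChargeLaw` (stmt-30251: site charge
`≤ η ℓ³` on all large cubes of a `μ`-ground state at a lower-bound chemical potential). [this file] -/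
theorem muCleanBalls_of_typeFreeLaw {D : ℝ} (h : TypeFreeLaw D) : MuCleanBalls D := by
  have hcube := cubeChargeLaw
  unfold Summit.AtomisticToContinuum.Crystallization.Theses.OverbindingBudget.CubeChargeLaw at hcube
  intro e hT hlb Y hUD hsolid hμ a ha1 ha2 t ht ht1 L hthin
  by_contra hno
  push Not at hno
  obtain ⟨η, hη, hbig⟩ := h e hT hlb Y hUD hsolid a ha1 ha2 t ht ht1 L hthin
    (fun q hq => by
      obtain ⟨y, hy, hd, hn⟩ := hno q hq
      exact ⟨y, hy, hd, hn⟩)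
  obtain ⟨ℓ₀, hℓ₀⟩ := hcube e hlb Y hUD hμ η hη
  obtain ⟨ℓ, c, F, hℓ, hF, hlt⟩ := hbig ℓ₀
  have habs := hℓ₀ ℓ c hℓ F hF
  exact absurd (lt_of_lt_of_le hlt (le_abs_self _)) (not_lt.mpr habs)

/-- `PeriodicDefectPricing → MuCleanBalls 10` (through `TypeFreeLaw 10`, generation 23). [this file] -/
theorem muCleanBalls_of_periodicDefectPricing (h : PeriodicDefectPricing) : MuCleanBalls 10 :=
  muCleanBalls_of_typeFreeLaw (typeFreeLaw_of_periodicDefectPricing h (by norm_num))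

/-- Monotonicity in the core radius: thinner cores are a stronger hypothesis, so the law for radius `D'` gives the law for `D ≤ D'`.
[this file] -/
theorem muCleanBalls_mono {D D' : ℝ} (hDD : D ≤ D') (h : MuCleanBalls D') : MuCleanBalls D := by
  intro e hT hlb Y hUD hsolid hμ a ha1 ha2 t ht ht1 L hthin
  exact h e hT hlb Y hUD hsolid hμ a ha1 ha2 t ht ht1 L (fun z => by
    obtain ⟨y, hy, hg, hb, hd⟩ := hthin z
    exact ⟨y, hy, hg, hb, hd.trans hDD⟩)

/-- **`MuCleanBalls 10` closes the hosted world.**  In `HostedTarget 10` the texture is a `μ`-ground state at `e`, hosted at some admissible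
spacing `a` with thin cores of radius `10`, and `ROBUST` supplies a margin `t > 0` and a radius `L` with `t`-robust violators `L`-dense at EVERY
admissible spacing — in particular at `a`; `MuCleanBalls` at margin `min t (1/10)` exhibits a clean `L`-ball, whose centre has no violator within
`L` (monotonicity of `RT` in the margin, `rt_mono`).  Contradiction; the windows follow vacuously. [this file] -/
theorem hostedTarget_of_muCleanBalls (h : MuCleanBalls 10) : HostedTarget 10 := by
  unfold HostedTarget
  intro e hT hlb x hx Y h0 hrec hlim hUD hμ hgap hsolid haper hup hlow hacc htwo hthin hrob hh
  obtain ⟨a, ha1, ha2, _hmat, hthin'⟩ := hh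
  obtain ⟨L, t, ht, hr⟩ := hrob
  obtain ⟨q, hq, hall⟩ := h e hT hlb Y hUD hsolid hμ a ha1 ha2 (min t (1 / 10)) (lt_min ht (by norm_num)) (min_le_right _ _) L hthin'
  obtain ⟨y, hy, hd, hn⟩ := hr q hq a ha1 ha2
  exact absurd (rt_mono hUD (min_le_left _ _) (hall y hy hd)) hn

/-- **The cone through the extremal class.**  `MuCleanBalls 10 ∧ CleanlessExcessT ∧ CoherentResidual 10 ⟹ RDEF` (the residuals of record,
generations 13–14). [this file] -/
theorem rdef_of_muCleanBalls_coherent (h : MuCleanBalls 10) (hCE : CleanlessExcessT) (hR : CoherentResidual 10) :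
    RobustDefectLimitWindows :=
  rdef_of_hosted_graded_coherent (hostedTarget_of_muCleanBalls h) hCE hR

/-! ## §B  The severity cut at a threshold margin `T₀` -/

/-- **`GrossCleanBalls T₀ D`** — the law at the single margin `T₀`: every admissible `μ`-ground state with thin cores of radius `D` has
`T₀`-clean balls of every radius.  At `T₀ = 1/250` the violators it excludes at density are the GROSS ones (coordination `≠ 12` in the
windows, a neighbour closer than `0.98a − T₀`, or a neighbour in the gap band `(1.02a + T₀, 1.26a − T₀)`): the PRICING residual. -/
def GrossCleanBalls (T₀ D : ℝ) : Prop :=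
  ∀ e : ℝ, Filter.Tendsto (fun N : ℕ => groundStateEnergy lennardJones 3 N / N) Filter.atTop (nhds e) →
    (∀ N : ℕ, 0 < N → e ≤ groundStateEnergy lennardJones 3 N / N) →
    ∀ Y : Set (EuclideanSpace ℝ (Fin 3)), UniformlyDiscrete Y → (∀ z : EuclideanSpace ℝ (Fin 3), ∃ w ∈ Y, dist z w < 9 / 10) →
      IsMuGSC lennardJones e Y →
      ∀ a : ℝ, 47 / 50 ≤ a → a ≤ 1 → ∀ L : ℝ, ThinCores a D Y →
        ∃ q ∈ Y, ∀ y ∈ Y, dist y q ≤ L → RT a T₀ Y y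

/-- **`SoftCleanBalls T₀ D`** — the law below the threshold, on textures that already have `T₀`-clean balls of every radius: then they have
`t`-clean balls of every radius for every `t ∈ (0, 1/10]`.  (For `t ≥ T₀` this is monotonicity; the content is `t < T₀`: SOFT violators —
sites of the correct gapped-twelve type whose distances are off by less than `T₀` — are not `L`-dense.  A REGULARITY statement.) -/
def SoftCleanBalls (T₀ D : ℝ) : Prop :=
  ∀ e : ℝ, Filter.Tendsto (fun N : ℕ => groundStateEnergy lennardJones 3 N / N) Filter.atTop (nhds e) →
    (∀ N : ℕ, 0 < N → e ≤ groundStateEnergy lennardJones 3 N / N) →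
    ∀ Y : Set (EuclideanSpace ℝ (Fin 3)), UniformlyDiscrete Y → (∀ z : EuclideanSpace ℝ (Fin 3), ∃ w ∈ Y, dist z w < 9 / 10) →
      IsMuGSC lennardJones e Y →
      ∀ a : ℝ, 47 / 50 ≤ a → a ≤ 1 → ∀ t : ℝ, 0 < t → t ≤ 1 / 10 → ∀ L : ℝ, ThinCores a D Y →
        (∀ R : ℝ, ∃ q ∈ Y, ∀ y ∈ Y, dist y q ≤ R → RT a T₀ Y y) →
        ∃ q ∈ Y, ∀ y ∈ Y, dist y q ≤ L → RT a t Y y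

/-- The gross law is the extremal law at one margin. [this file] -/
theorem grossCleanBalls_of_muCleanBalls {T₀ D : ℝ} (hT : 0 < T₀) (hT1 : T₀ ≤ 1 / 10) (h : MuCleanBalls D) : GrossCleanBalls T₀ D :=
  fun e hT' hlb Y hUD hsolid hμ a ha1 ha2 L hthin => h e hT' hlb Y hUD hsolid hμ a ha1 ha2 T₀ hT hT1 L hthin

/-- The soft law is the extremal law with an extra hypothesis. [this file] -/
theorem softCleanBalls_of_muCleanBalls {T₀ D : ℝ} (h : MuCleanBalls D) : SoftCleanBalls T₀ D :=
  fun e hT' hlb Y hUD hsolid hμ a ha1 ha2 t ht ht1 L hthin _ => h e hT' hlb Y hUD hsolid hμ a ha1 ha2 t ht ht1 L hthin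

/-- **The severity cut glues.**  `GrossCleanBalls T₀ D ∧ SoftCleanBalls T₀ D ⟹ MuCleanBalls D` for `T₀ ∈ (0, 1/10]`: margins `t ≥ T₀` by
monotonicity of `RT` in the margin from the gross law; margins `t < T₀` from the soft law, whose extra hypothesis the gross law supplies at
every radius. [this file] -/
theorem muCleanBalls_of_gross_soft {T₀ D : ℝ} (hG : GrossCleanBalls T₀ D) (hS : SoftCleanBalls T₀ D) : MuCleanBalls D := by
  intro e hT' hlb Y hUD hsolid hμ a ha1 ha2 t ht ht1 L hthin
  by_cases hle : T₀ ≤ t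
  · obtain ⟨q, hq, hall⟩ := hG e hT' hlb Y hUD hsolid hμ a ha1 ha2 L hthin
    exact ⟨q, hq, fun y hy hd => rt_mono hUD hle (hall y hy hd)⟩
  · exact hS e hT' hlb Y hUD hsolid hμ a ha1 ha2 t ht ht1 L hthin fun R => hG e hT' hlb Y hUD hsolid hμ a ha1 ha2 R hthin

/-- **The severity cut is exact:** `MuCleanBalls D ⟺ GrossCleanBalls T₀ D ∧ SoftCleanBalls T₀ D`, every `T₀ ∈ (0, 1/10]`. [this file] -/
theorem muCleanBalls_iff_gross_soft {T₀ D : ℝ} (hT : 0 < T₀) (hT1 : T₀ ≤ 1 / 10) :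
    MuCleanBalls D ↔ GrossCleanBalls T₀ D ∧ SoftCleanBalls T₀ D :=
  ⟨fun h => ⟨grossCleanBalls_of_muCleanBalls hT hT1 h, softCleanBalls_of_muCleanBalls h⟩, fun h => muCleanBalls_of_gross_soft h.1 h.2⟩

/-- Monotonicity of the gross law in the threshold: a larger threshold is a weaker law. [this file] -/
theorem grossCleanBalls_mono {T₀ T₁ D : ℝ} (hTT : T₀ ≤ T₁) (h : GrossCleanBalls T₀ D) : GrossCleanBalls T₁ D := by
  intro e hT' hlb Y hUD hsolid hμ a ha1 ha2 L hthin
  obtain ⟨q, hq, hall⟩ := h e hT' hlb Y hUD hsolid hμ a ha1 ha2 L hthin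
  exact ⟨q, hq, fun y hy hd => rt_mono hUD hTT (hall y hy hd)⟩

/-- **The cut cone.**  `GrossCleanBalls T₀ 10 ∧ SoftCleanBalls T₀ 10 ∧ CleanlessExcessT ∧ CoherentResidual 10 ⟹ RDEF`. [this file] -/
theorem rdef_of_gross_soft_coherent {T₀ : ℝ} (hG : GrossCleanBalls T₀ 10) (hS : SoftCleanBalls T₀ 10) (hCE : CleanlessExcessT)
    (hR : CoherentResidual 10) : RobustDefectLimitWindows :=
  rdef_of_muCleanBalls_coherent (muCleanBalls_of_gross_soft hG hS) hCE hR

/-! ## §C  ε-regularity and the Liouville statement -/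

/-- **`CleanRegularity T₀ D`** — ε-REGULARITY of `μ`-ground states (local, quantitative, uniform over the texture): for every limiting
density `e`, separation `δ`, admissible spacing `a`, margin `t ∈ (0, 1/10]` and radius `L` there is `R` such that in every `δ`-separated
`9/10`-covering `μ`-ground state at `e` with thin cores of radius `D`, every `T₀`-clean `R`-ball `B(q, R)` contains a `t`-clean `L`-ball
`B(q', L)`, `dist q' q ≤ R`.  No energy functional, no periodicity, no charge: a rigidity statement about strained gapped-twelve matter. -/
def CleanRegularity (T₀ D : ℝ) : Prop :=
  ∀ e : ℝ, Filter.Tendsto (fun N : ℕ => groundStateEnergy lennardJones 3 N / N) Filter.atTop (nhds e) →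
    (∀ N : ℕ, 0 < N → e ≤ groundStateEnergy lennardJones 3 N / N) →
    ∀ δ : ℝ, 0 < δ → ∀ a : ℝ, 47 / 50 ≤ a → a ≤ 1 → ∀ t : ℝ, 0 < t → t ≤ 1 / 10 → ∀ L : ℝ, ∃ R : ℝ,
      ∀ Y : Set (EuclideanSpace ℝ (Fin 3)), (∀ p ∈ Y, ∀ q ∈ Y, p ≠ q → δ ≤ dist p q) →
        (∀ z : EuclideanSpace ℝ (Fin 3), ∃ w ∈ Y, dist z w < 9 / 10) → IsMuGSC lennardJones e Y → ThinCores a D Y →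
        ∀ q ∈ Y, (∀ y ∈ Y, dist y q ≤ R → RT a T₀ Y y) → ∃ q' ∈ Y, dist q' q ≤ R ∧ ∀ y ∈ Y, dist y q' ≤ L → RT a t Y y

/-- **ε-regularity gives the soft law**: apply it inside one of the `T₀`-clean `R`-balls the soft law's hypothesis provides. [this file] -/
theorem softCleanBalls_of_cleanRegularity {T₀ D : ℝ} (h : CleanRegularity T₀ D) : SoftCleanBalls T₀ D := by
  intro e hT' hlb Y hUD hsolid hμ a ha1 ha2 t ht ht1 L hthin hballs
  obtain ⟨δ, hδ, hsep⟩ := hUD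
  obtain ⟨R, hR⟩ := h e hT' hlb δ hδ a ha1 ha2 t ht ht1 L
  obtain ⟨q, hq, hclean⟩ := hballs R
  obtain ⟨q', hq', -, hgood⟩ := hR Y hsep hsolid hμ hthin q hq hclean
  exact ⟨q', hq', hgood⟩

/-- **`CleanLiouville T₀ D`** — the blow-down statement: a uniformly discrete `9/10`-covering (closed form) `μ`-ground state at a limiting
density `e`, with LOOSENED thin cores of radius `D` (`ThinCoresL`, the limit-stable form) at an admissible spacing `a`, which passes the relaxed
test at EVERY site at every margin above `T₀`, passes it at every site at EVERY positive margin: globally `T₀`-clean ground states carry no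
soft violators at all.  (File 2: `CleanLiouville T₀ D → CleanRegularity T₀ D` modulo `MuGSCLimitClosed`, by compactness of textures under
two-way local matchings.) -/
def CleanLiouville (T₀ D : ℝ) : Prop :=
  ∀ e : ℝ, Filter.Tendsto (fun N : ℕ => groundStateEnergy lennardJones 3 N / N) Filter.atTop (nhds e) →
    (∀ N : ℕ, 0 < N → e ≤ groundStateEnergy lennardJones 3 N / N) →
    ∀ Y : Set (EuclideanSpace ℝ (Fin 3)), UniformlyDiscrete Y → (∀ z : EuclideanSpace ℝ (Fin 3), ∃ w ∈ Y, dist z w ≤ 9 / 10) →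
      IsMuGSC lennardJones e Y →
      ∀ a : ℝ, 47 / 50 ≤ a → a ≤ 1 → ThinCoresL a D Y → (∀ y ∈ Y, ∀ s : ℝ, T₀ < s → RT a s Y y) →
        ∀ t : ℝ, 0 < t → ∀ y ∈ Y, RT a t Y y

/-- Monotonicity of the Liouville statement in the threshold: a smaller threshold is a weaker statement (stronger hypothesis). [this file] -/
theorem cleanLiouville_anti {T₀ T₁ D : ℝ} (hTT : T₀ ≤ T₁) (h : CleanLiouville T₁ D) : CleanLiouville T₀ D :=
  fun e hT' hlb Y hUD hsolid hμ a ha1 ha2 hthin hclean =>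
    h e hT' hlb Y hUD hsolid hμ a ha1 ha2 hthin fun y hy s hs => hclean y hy s (lt_of_le_of_lt hTT hs)

/-! ## §D  The closure hypothesis -/

/-- **`MuGSCLimitClosed`** — `μ`-ground states of the Lennard-Jones potential are closed under two-way local limits: if `δ`-separated
`μ`-ground states `Zs k` at chemical potential `e` match a `δ`-separated texture `Z` about `0` with every precision `ε > 0` on every radius
`R` for all large `k` (`Match ε R 0 (Zs k) Z`), then `Z` is a `μ`-ground state at `e`.  Folklore (continuity of `U − μ·#` of finite
modifications under local matchings, `r⁻⁶` tails); proved verbatim in the sibling import world as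
`…RepetitiveNetworkReductionRecurrentMember.isMuGSC_of_limit` (over `BallMatch`/`MuGroundStateConfiguration`, not importable next to
`Literature…MuGSC`), to be ported.  A HYPOTHESIS of file 2's compactness argument, not a claim of this node. -/
def MuGSCLimitClosed : Prop :=
  ∀ e δ : ℝ, 0 < δ → ∀ Zs : ℕ → Set (EuclideanSpace ℝ (Fin 3)), ∀ Z : Set (EuclideanSpace ℝ (Fin 3)),
    (∀ k, ∀ p ∈ Zs k, ∀ q ∈ Zs k, p ≠ q → δ ≤ dist p q) → (∀ k, IsMuGSC lennardJones e (Zs k)) →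
    (∀ p ∈ Z, ∀ q ∈ Z, p ≠ q → δ ≤ dist p q) → (∀ R ε : ℝ, 0 < ε → ∀ᶠ k in Filter.atTop, Match ε R 0 (Zs k) Z) →
    IsMuGSC lennardJones e Z

end Summit.AtomisticToContinuum.Crystallization.Theorems.OverbindingBudgetRegularityCutStatements
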